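import Literature.AnabelianGeometry.EtaleTheta.Discharge.Sec2Cor219iiiHeartAtValue
import Literature.AnabelianGeometry.EtaleTheta.Discharge.Sec2Cor219iiiTowerAssembly
import Literature.AnabelianGeometry.EtaleTheta.CyclotomeTowerAllLevels
import HarnessLib

/-!
# [EtTh] Cor. 2.19 (iii) from the VALUE of the transported root cocycle at ONE point, for a level-CONSTANT conjugator
# (row «COR219III-M1b», constant route `x M := w`; proof-only, GENERIC over every §1 setting)

S. Mochizuki, *The Étale Theta Function and its Frobenioid-theoretic Manifestations* [EtTh], Publ. RIMS **45** (2009), §2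
Cor. 2.19 (iii) p. 64 [cite: MochizukiEtTh2009, Cor 2.19 (iii) p.64].  Cell `abc-iut`, row «COR219III-M1b» (abc-iut-L6-lead gen 7
ruling 2026-08-27T02:48:56Z: CONSTANT route, no M2), seat abc-iut-L1-t6 (gen 5); sequel of `Sec2Cor219iiiHeartAtValue` (p488904).
PROOF-ONLY and GENERIC (no model); nothing of another seat is restated — abc-iut-f-142's `exists_transport` (clauses (a)(b)(c)),
`uniqueness_on_DeltaP_of_dense`, `transport_coe_eq_conjRoot_coe_of_mem`, `conjRoot_mul_of_aug_eq_one`, the local-constancy lemmas,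
and abc-iut-C-hgal-2's `cor219_iii_of_hearts_of_origin` (p482618) are consumed BY NAME.

* §1 **`heart_of_value_at`** / **`heart_of_value_at'`** — p488904's single-value socket with the conjugator a GENERAL
  `w ∈ Π^tp_X̲̲` (not a power `ã^m` of a geometric element): if `red_M (F b̃) = red_M (conjRoot w f b̃)` at ONE `b ∈ Δ_P` and
  (D1*) uniqueness on `Δ_P` holds at `b`, then `red_M ∘ F = red_M ∘ conjRoot w f` on `Δ_P`.
* §2 **`cor219_iii_of_const_conjugator_of_origin`** — the level-COMPATIBLE knit of `cor219_iii_of_hearts_of_origin` on the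
  constant route: its «hearts ∧ (b2)» clause is REPLACED by a point `b ∈ Δ_P` with abc-iut-f-142's density hypothesis
  (`Dense (closure {Δ_P ∩ θ⁻¹Δ_Θ, b})`) and, per `(γ, γ̃)`, «`∃ f₀ ∈ rootCocycles, ∃ w, ∀ M, red_M (γ̃⁻¹ f₀(γ b̃)) = red_M (conjRoot w f₀ b̃)`»;
  hearts at EVERY level by §1, `x M := w` constant so (b2) is `rfl`.  At the Tate model the density is abc-iut-L1-t6's
  `dense_closure_heart_record` (p488563) and the value clause is what row «COR219III-M1b-EVEN (β)» / (β1) supplies.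
* §3 **`heart_of_residue`** — the `ã^m`-socket of p488904 with its value hypothesis traded for a RESIDUE identity in `l·Δ_Θ`
  (`F(b̃)·f(b̃)⁻¹ = θ⁅(ã^m)⁻¹, b⁆ · y^M`), the entry point of the explicit-`m_M` (M2) route — kept for the record.

HONEST FRAMING: statements about OUR typed objects over an abstract §1 setting; nothing of [EtTh] (refereed) is asserted for a
curve; no side is taken on [IUTchIII] Cor. 3.12; typed ≠ proved.
-/

noncomputable section

namespace Literature.AnabelianGeometry.EtaleTheta

open Literature.AnabelianGeometry.SemiGraphs

namespace ThetaSetting.EtaleThetaData.DoubleUnderline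

variable {p : ℕ} [Fact p.Prime] {D : ThetaSetting p} {E : D.EtaleThetaData} {l : ℕ}
  (C : E.DoubleUnderline l) {Es : Set ℕ+} (τ : D.CyclotomeTower l Es)

/-! ## §1. The single-value socket for a GENERAL conjugator `w ∈ Π^tp_X̲̲` -/

/-- **The Δ_P-heart for a general conjugator `w` from ONE value**: if the two locally constant, Δ_P-multiplicative maps
`red_M ∘ F` and `red_M ∘ conjRoot w f` (which agree on `Δ_P ∩ θ⁻¹(Δ_Θ)` for ANY `w` — transport tautology) agree at a point
`b ∈ Δ_P` at which (D1*) uniqueness holds, they agree on `Δ_P`. [cite: MochizukiEtTh2009, Cor 2.19 (iii) p.64] -/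
theorem heart_of_value_at (hC : D.Compat) (hS : D.Sec2Hyps) (h15 : Prop15iii E hC)
    (γ : (C.thetaEnvTower τ hC hS).PiX ≃ₜ* (C.thetaEnvTower τ hC hS).PiX)
    (hγ : (C.thetaEnvTower τ hC hS).PiYdd.map γ.toMulEquiv.toMonoidHom = (C.thetaEnvTower τ hC hS).PiYdd)
    (hL : (C.thetaEnvTower τ hC hS).lDeltaTheta.map γ.toMulEquiv.toMonoidHom = (C.thetaEnvTower τ hC hS).lDeltaTheta)
    (γΛ : D.lDeltaTheta l ≃* D.lDeltaTheta l)
    (hγΛ : ∀ (g : (C.thetaEnvTower τ hC hS).lDeltaTheta) (hg : γ g ∈ (C.thetaEnvTower τ hC hS).lDeltaTheta),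
      C.toLDelta ⟨γ g, hg⟩ = γΛ (C.toLDelta g))
    {f : contCocycles D.toTheta D.DeltaTheta C.GtpYdduu} (hf : f ∈ C.rootCocycles hC)
    (F : C.GtpYdduu → D.lDeltaTheta l)
    (hF : ∀ g : (C.thetaEnvTower τ hC hS).PiYdd,
      F (C.inclYdduu g) = γΛ.symm ⟨(f.1 (C.inclYdduu ⟨γ g, C.apply_mem_PiYdd τ hC hS γ hγ g⟩) : D.GtpTheta), hf.1 _⟩)
    (hFmul : ∀ g h : C.GtpYdduu, (F (g * h) : D.GtpTheta) =
      (F g : D.GtpTheta) * (D.toTheta (g : D.PiTemp) * (F h : D.GtpTheta) * (D.toTheta (g : D.PiTemp))⁻¹))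
    (w : C.Huu)
    (b : (C.thetaEnvTower τ hC hS).PiYdd) (M : Es)
    -- (D1*) uniqueness on `Δ_P`
    (huniq : ∀ φ ψ : (C.thetaEnvTower τ hC hS).PiYdd → MuN p M, IsLocallyConstant φ → IsLocallyConstant ψ →
      (∀ g h : (C.thetaEnvTower τ hC hS).PiYdd, D.aug.toMonoidHom ((g : C.Huu) : D.PiTemp) = 1 →
        D.aug.toMonoidHom ((h : C.Huu) : D.PiTemp) = 1 → φ (g * h) = φ g * φ h) →
      (∀ g h : (C.thetaEnvTower τ hC hS).PiYdd, D.aug.toMonoidHom ((g : C.Huu) : D.PiTemp) = 1 →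
        D.aug.toMonoidHom ((h : C.Huu) : D.PiTemp) = 1 → ψ (g * h) = ψ g * ψ h) →
      (∀ g : (C.thetaEnvTower τ hC hS).PiYdd, D.aug.toMonoidHom ((g : C.Huu) : D.PiTemp) = 1 →
        D.toTheta ((g : C.Huu) : D.PiTemp) ∈ D.DeltaTheta → φ g = ψ g) →
      φ b = ψ b →
      ∀ g : (C.thetaEnvTower τ hC hS).PiYdd, D.aug.toMonoidHom ((g : C.Huu) : D.PiTemp) = 1 → φ g = ψ g)
    -- the VALUE at `b`: `red_M (F b̃) = red_M (conjRoot w f b̃)`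
    (hval : (τ.mod M).red (F (C.inclYdduu b)) =
      (τ.mod M).red ⟨(C.conjRoot hC w f.1 (C.inclYdduu b) : D.GtpTheta), (D.lDeltaTheta_normal l).conj_mem _ (hf.1 _) _⟩)
    -- local constancy of the two sides
    (hFlc : IsLocallyConstant fun g : (C.thetaEnvTower τ hC hS).PiYdd => (τ.mod M).red (F (C.inclYdduu g)))
    (hclc : IsLocallyConstant fun g : (C.thetaEnvTower τ hC hS).PiYdd =>
      (τ.mod M).red ⟨(C.conjRoot hC w f.1 (C.inclYdduu g) : D.GtpTheta),
        (D.lDeltaTheta_normal l).conj_mem _ (hf.1 _) _⟩) :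
    ∀ g : (C.thetaEnvTower τ hC hS).PiYdd, D.aug.toMonoidHom ((g : C.Huu) : D.PiTemp) = 1 →
      (τ.mod M).red (F (C.inclYdduu g)) =
        (τ.mod M).red ⟨(C.conjRoot hC w f.1 (C.inclYdduu g) : D.GtpTheta),
          (D.lDeltaTheta_normal l).conj_mem _ (hf.1 _) _⟩ := by
  refine huniq _ _ hFlc hclc ?_ ?_ ?_ hval
  · -- `red_M ∘ F` is multiplicative on `Δ_P` (cocycle law (b) of the transport)
    intro g h hg _
    rw [map_mul, C.transport_mul_of_aug_eq_one F hFmul _ _ hg, map_mul]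
  · -- `red_M ∘ conjRoot w f` is multiplicative on `Δ_P`
    intro g h hg _
    rw [← map_mul]
    congr 1
    apply Subtype.ext
    change (C.conjRoot hC w f.1 (C.inclYdduu (g * h)) : D.GtpTheta) =
      (C.conjRoot hC w f.1 (C.inclYdduu g) : D.GtpTheta) * (C.conjRoot hC w f.1 (C.inclYdduu h) : D.GtpTheta)
    rw [map_mul, C.conjRoot_mul_of_aug_eq_one hC f w _ _ hg, Subgroup.coe_mul]
  · -- agreement on `Δ_P ∩ θ⁻¹(Δ_Θ)` (the transport tautology, any conjugator)
    intro g _ hk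
    congr 1
    apply Subtype.ext
    exact C.transport_coe_eq_conjRoot_coe_of_mem τ hC hS h15 γ hγ hL γΛ hγΛ hf F hF w g hk

/-- **`heart_of_value_at` with the local-constancy hypotheses DISCHARGED** (abc-iut-f-142's `transport_red_isLocallyConstant` /
`conjRoot_red_isLocallyConstant`), given the admitted `γ̄_M` and clause (c) `hFc` of the transport.
[cite: MochizukiEtTh2009, Cor 2.19 (iii) p.64] -/
theorem heart_of_value_at' (hC : D.Compat) (hS : D.Sec2Hyps) (h15 : Prop15iii E hC)
    (γ : (C.thetaEnvTower τ hC hS).PiX ≃ₜ* (C.thetaEnvTower τ hC hS).PiX)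
    (hγ : (C.thetaEnvTower τ hC hS).PiYdd.map γ.toMulEquiv.toMonoidHom = (C.thetaEnvTower τ hC hS).PiYdd)
    (hL : (C.thetaEnvTower τ hC hS).lDeltaTheta.map γ.toMulEquiv.toMonoidHom = (C.thetaEnvTower τ hC hS).lDeltaTheta)
    (γΛ : D.lDeltaTheta l ≃* D.lDeltaTheta l)
    (hγΛ : ∀ (g : (C.thetaEnvTower τ hC hS).lDeltaTheta) (hg : γ g ∈ (C.thetaEnvTower τ hC hS).lDeltaTheta),
      C.toLDelta ⟨γ g, hg⟩ = γΛ (C.toLDelta g))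
    (M : Es) (γμ : (C.thetaEnvTower τ hC hS).mu M ≃* (C.thetaEnvTower τ hC hS).mu M)
    {f : contCocycles D.toTheta D.DeltaTheta C.GtpYdduu} (hf : f ∈ C.rootCocycles hC)
    (F : C.GtpYdduu → D.lDeltaTheta l)
    (hF : ∀ g : (C.thetaEnvTower τ hC hS).PiYdd,
      F (C.inclYdduu g) = γΛ.symm ⟨(f.1 (C.inclYdduu ⟨γ g, C.apply_mem_PiYdd τ hC hS γ hγ g⟩) : D.GtpTheta), hf.1 _⟩)
    (hFmul : ∀ g h : C.GtpYdduu, (F (g * h) : D.GtpTheta) =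
      (F g : D.GtpTheta) * (D.toTheta (g : D.PiTemp) * (F h : D.GtpTheta) * (D.toTheta (g : D.PiTemp))⁻¹))
    (hFc : (C.thetaEnvTower τ hC hS).pullbackCocycle M γ hγ γμ (C.modN (τ.mod M) f hf.1) =
      fun g => (τ.mod M).red (F (C.inclYdduu g)))
    (w : C.Huu)
    (b : (C.thetaEnvTower τ hC hS).PiYdd)
    (huniq : ∀ φ ψ : (C.thetaEnvTower τ hC hS).PiYdd → MuN p M, IsLocallyConstant φ → IsLocallyConstant ψ →
      (∀ g h : (C.thetaEnvTower τ hC hS).PiYdd, D.aug.toMonoidHom ((g : C.Huu) : D.PiTemp) = 1 →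
        D.aug.toMonoidHom ((h : C.Huu) : D.PiTemp) = 1 → φ (g * h) = φ g * φ h) →
      (∀ g h : (C.thetaEnvTower τ hC hS).PiYdd, D.aug.toMonoidHom ((g : C.Huu) : D.PiTemp) = 1 →
        D.aug.toMonoidHom ((h : C.Huu) : D.PiTemp) = 1 → ψ (g * h) = ψ g * ψ h) →
      (∀ g : (C.thetaEnvTower τ hC hS).PiYdd, D.aug.toMonoidHom ((g : C.Huu) : D.PiTemp) = 1 →
        D.toTheta ((g : C.Huu) : D.PiTemp) ∈ D.DeltaTheta → φ g = ψ g) →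
      φ b = ψ b →
      ∀ g : (C.thetaEnvTower τ hC hS).PiYdd, D.aug.toMonoidHom ((g : C.Huu) : D.PiTemp) = 1 → φ g = ψ g)
    (hval : (τ.mod M).red (F (C.inclYdduu b)) =
      (τ.mod M).red ⟨(C.conjRoot hC w f.1 (C.inclYdduu b) : D.GtpTheta), (D.lDeltaTheta_normal l).conj_mem _ (hf.1 _) _⟩) :
    ∀ g : (C.thetaEnvTower τ hC hS).PiYdd, D.aug.toMonoidHom ((g : C.Huu) : D.PiTemp) = 1 →
      (τ.mod M).red (F (C.inclYdduu g)) =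
        (τ.mod M).red ⟨(C.conjRoot hC w f.1 (C.inclYdduu g) : D.GtpTheta),
          (D.lDeltaTheta_normal l).conj_mem _ (hf.1 _) _⟩ :=
  C.heart_of_value_at τ hC hS h15 γ hγ hL γΛ hγΛ hf F hF hFmul w b M huniq hval
    (C.transport_red_isLocallyConstant τ hC hS M γ hγ γμ hf F hFc)
    (C.conjRoot_red_isLocallyConstant τ hC hS M hf w)

/-! ## §2. Cor. 2.19 (iii) at an origin on the CONSTANT route -/

/-- **Cor. 2.19 (iii) at an origin from ONE value per `(γ, γ̃)` with a level-CONSTANT conjugator.**  Over an origin setting with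
open augmentation on `Π^tp_Ÿ̲̲`, fix `b ∈ Π^tp_Ÿ̲̲` (at the model: a point of `Δ_P`) such that the subgroup of `Δ_P` generated by `Δ_P ∩ θ⁻¹(Δ_Θ)` and `b` is dense
(abc-iut-f-142's (D1*) input).  If every admissible `(γ, γ̄)` stabilises `Ker θ` and `θ⁻¹(l·Δ_Θ)` and, for every induced `γ̃`,
some root cocycle `f₀` and some `w ∈ Π^tp_X̲̲` satisfy `red_M (γ̃⁻¹ f₀(γ b̃)) = red_M (conjRoot w f₀ b̃)` at EVERY level `M`, then
`T.Cor219_iii` holds: hearts at every level by `heart_of_value_at'` (transport = `exists_transport`), and the level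
compatibility (b2) of `cor219_iii_of_hearts_of_origin` is `rfl` for the constant `x M := w`. [cite: MochizukiEtTh2009, Cor 2.19 (iii) p.65] -/
theorem cor219_iii_of_const_conjugator_of_origin (hO : D.IsEtThOrigin) (hC : D.Compat) (hS : D.Sec2Hyps)
    (h15 : Prop15iii E hC)
    (hopen : IsOpenMap fun g : (C.thetaEnvTower τ hC hS).PiYdd =>
      (C.thetaEnvTower τ hC hS).aug (g : (C.thetaEnvTower τ hC hS).PiX))
    (b : (C.thetaEnvTower τ hC hS).PiYdd)
    (hdense : Dense ((Subgroup.closure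
        {x : ↥(D.aug.toMonoidHom.comp (C.Huu.subtype.comp ((C.thetaEnvTower τ hC hS).PiYdd).subtype)).ker |
          D.toTheta ((((x : (C.thetaEnvTower τ hC hS).PiYdd) : C.Huu)) : D.PiTemp) ∈ D.DeltaTheta ∨
            (x : (C.thetaEnvTower τ hC hS).PiYdd) = b} :
        Subgroup ↥(D.aug.toMonoidHom.comp (C.Huu.subtype.comp ((C.thetaEnvTower τ hC hS).PiYdd).subtype)).ker) :
      Set ↥(D.aug.toMonoidHom.comp (C.Huu.subtype.comp ((C.thetaEnvTower τ hC hS).PiYdd).subtype)).ker))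
    (H : ∀ (γ : (C.thetaEnvTower τ hC hS).PiX ≃ₜ* (C.thetaEnvTower τ hC hS).PiX)
      (hγ : (C.thetaEnvTower τ hC hS).PiYdd.map γ.toMulEquiv.toMonoidHom = (C.thetaEnvTower τ hC hS).PiYdd)
      (γμ : ∀ M : Es, (C.thetaEnvTower τ hC hS).mu M ≃* (C.thetaEnvTower τ hC hS).mu M)
      (_ : ∀ (M : Es) (g : (C.thetaEnvTower τ hC hS).lDeltaTheta) (hg : γ g ∈ (C.thetaEnvTower τ hC hS).lDeltaTheta),
        (C.thetaEnvTower τ hC hS).thetaMod M ⟨γ g, hg⟩ = γμ M ((C.thetaEnvTower τ hC hS).thetaMod M g)),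
      (D.toTheta.comp C.Huu.subtype).ker.map γ.toMulEquiv.toMonoidHom = (D.toTheta.comp C.Huu.subtype).ker ∧
      (C.thetaEnvTower τ hC hS).lDeltaTheta.map γ.toMulEquiv.toMonoidHom = (C.thetaEnvTower τ hC hS).lDeltaTheta ∧
      ∀ (γΛ : D.lDeltaTheta l ≃* D.lDeltaTheta l)
        (_ : ∀ (g : (C.thetaEnvTower τ hC hS).lDeltaTheta) (hg : γ g ∈ (C.thetaEnvTower τ hC hS).lDeltaTheta),
          C.toLDelta ⟨γ g, hg⟩ = γΛ (C.toLDelta g)),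
        ∃ (f₀ : contCocycles D.toTheta D.DeltaTheta C.GtpYdduu) (hf₀ : f₀ ∈ C.rootCocycles hC) (w : C.Huu),
          ∀ M : Es,
            (τ.mod M).red (γΛ.symm ⟨(f₀.1 (C.inclYdduu ⟨γ b, C.apply_mem_PiYdd τ hC hS γ hγ b⟩) : D.GtpTheta),
              hf₀.1 _⟩) =
              (τ.mod M).red ⟨(C.conjRoot hC w f₀.1 (C.inclYdduu b) : D.GtpTheta),
                (D.lDeltaTheta_normal l).conj_mem _ (hf₀.1 _) _⟩) :
    (C.thetaEnvTower τ hC hS).Cor219_iii := by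
  refine C.cor219_iii_of_hearts_of_origin τ hO hC hS hopen fun γ hγ γμ hcompat => ?_
  obtain ⟨hker, hL, hrest⟩ := H γ hγ γμ hcompat
  refine ⟨hker, hL, fun γΛ hγΛ => ?_⟩
  obtain ⟨f₀, hf₀, w, hval⟩ := hrest γΛ hγΛ
  refine ⟨f₀, hf₀, fun _ => w, fun M g hg => ?_, fun M M' _ g => rfl⟩
  -- the transport `F = Φ_γ f₀` with its clauses (a)(b)(c), and the heart at level `M` from the value at `b`
  obtain ⟨F, hF, hFmul, hFc⟩ := C.exists_transport τ hC hS γ hγ hL γΛ hγΛ f₀ hf₀.1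
  have hvalF : (τ.mod M).red (F (C.inclYdduu b)) =
      (τ.mod M).red ⟨(C.conjRoot hC w f₀.1 (C.inclYdduu b) : D.GtpTheta),
        (D.lDeltaTheta_normal l).conj_mem _ (hf₀.1 _) _⟩ := by
    rw [hF b]; exact hval M
  have hheart := C.heart_of_value_at' τ hC hS h15 γ hγ hL γΛ hγΛ M (γμ M) hf₀ F hF hFmul (hFc M (γμ M) (hcompat M)) w b
    (C.uniqueness_on_DeltaP_of_dense τ hC hS M b hdense) hvalF g hg
  rw [hF g] at hheart
  exact hheart

/-! ## §3. The `ã^m`-socket from a RESIDUE identity in `l·Δ_Θ` (entry point of the explicit-`m_M` route; kept for the record) -/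

/-- **The Δ_P-heart for a PRESCRIBED conjugator `ã^m` from a RESIDUE identity**: if `F(b̃)·f(b̃)⁻¹ = θ⁅(ã^m)⁻¹, b⁆ · y^M`
in `l·Δ_Θ` (some `y ∈ l·Δ_Θ`), then `red_M ∘ F = red_M ∘ conjRoot (ã^m) f` on `Δ_P` (via `heart_of_uniqueness_at'`,
`red_M (y^M) = 1`). [cite: MochizukiEtTh2009, Cor 2.19 (iii) p.64] -/
theorem heart_of_residue (hC : D.Compat) (hS : D.Sec2Hyps) (h15 : Prop15iii E hC)
    (γ : (C.thetaEnvTower τ hC hS).PiX ≃ₜ* (C.thetaEnvTower τ hC hS).PiX)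
    (hγ : (C.thetaEnvTower τ hC hS).PiYdd.map γ.toMulEquiv.toMonoidHom = (C.thetaEnvTower τ hC hS).PiYdd)
    (hL : (C.thetaEnvTower τ hC hS).lDeltaTheta.map γ.toMulEquiv.toMonoidHom = (C.thetaEnvTower τ hC hS).lDeltaTheta)
    (γΛ : D.lDeltaTheta l ≃* D.lDeltaTheta l)
    (hγΛ : ∀ (g : (C.thetaEnvTower τ hC hS).lDeltaTheta) (hg : γ g ∈ (C.thetaEnvTower τ hC hS).lDeltaTheta),
      C.toLDelta ⟨γ g, hg⟩ = γΛ (C.toLDelta g))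
    (M : Es) (γμ : (C.thetaEnvTower τ hC hS).mu M ≃* (C.thetaEnvTower τ hC hS).mu M)
    {f : contCocycles D.toTheta D.DeltaTheta C.GtpYdduu} (hf : f ∈ C.rootCocycles hC)
    (F : C.GtpYdduu → D.lDeltaTheta l)
    (hF : ∀ g : (C.thetaEnvTower τ hC hS).PiYdd,
      F (C.inclYdduu g) = γΛ.symm ⟨(f.1 (C.inclYdduu ⟨γ g, C.apply_mem_PiYdd τ hC hS γ hγ g⟩) : D.GtpTheta), hf.1 _⟩)
    (hFmul : ∀ g h : C.GtpYdduu, (F (g * h) : D.GtpTheta) =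
      (F g : D.GtpTheta) * (D.toTheta (g : D.PiTemp) * (F h : D.GtpTheta) * (D.toTheta (g : D.PiTemp))⁻¹))
    (hFc : (C.thetaEnvTower τ hC hS).pullbackCocycle M γ hγ γμ (C.modN (τ.mod M) f hf.1) =
      fun g => (τ.mod M).red (F (C.inclYdduu g)))
    (a : C.Huu) (ha : D.aug.toMonoidHom (a : D.PiTemp) = 1)
    (b : (C.thetaEnvTower τ hC hS).PiYdd) (hb : D.aug.toMonoidHom ((b : C.Huu) : D.PiTemp) = 1)
    (huniq : ∀ φ ψ : (C.thetaEnvTower τ hC hS).PiYdd → MuN p M, IsLocallyConstant φ → IsLocallyConstant ψ →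
      (∀ g h : (C.thetaEnvTower τ hC hS).PiYdd, D.aug.toMonoidHom ((g : C.Huu) : D.PiTemp) = 1 →
        D.aug.toMonoidHom ((h : C.Huu) : D.PiTemp) = 1 → φ (g * h) = φ g * φ h) →
      (∀ g h : (C.thetaEnvTower τ hC hS).PiYdd, D.aug.toMonoidHom ((g : C.Huu) : D.PiTemp) = 1 →
        D.aug.toMonoidHom ((h : C.Huu) : D.PiTemp) = 1 → ψ (g * h) = ψ g * ψ h) →
      (∀ g : (C.thetaEnvTower τ hC hS).PiYdd, D.aug.toMonoidHom ((g : C.Huu) : D.PiTemp) = 1 →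
        D.toTheta ((g : C.Huu) : D.PiTemp) ∈ D.DeltaTheta → φ g = ψ g) →
      φ b = ψ b →
      ∀ g : (C.thetaEnvTower τ hC hS).PiYdd, D.aug.toMonoidHom ((g : C.Huu) : D.PiTemp) = 1 → φ g = ψ g)
    (m : ℤ)
    (hm : D.toTheta ((((a ^ m : C.Huu) : D.PiTemp))⁻¹ * ((b : C.Huu) : D.PiTemp) *
        ((a ^ m : C.Huu) : D.PiTemp) * (((b : C.Huu) : D.PiTemp))⁻¹) ∈ D.lDeltaTheta l)
    (y : D.lDeltaTheta l)
    (hval : (F (C.inclYdduu b) : D.GtpTheta) * ((f.1 (C.inclYdduu b) : D.GtpTheta))⁻¹ =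
      ((⟨_, hm⟩ : D.lDeltaTheta l) : D.GtpTheta) * ((y ^ ((M : ℕ+) : ℕ) : D.lDeltaTheta l) : D.GtpTheta)) :
    ∀ g : (C.thetaEnvTower τ hC hS).PiYdd, D.aug.toMonoidHom ((g : C.Huu) : D.PiTemp) = 1 →
      (τ.mod M).red (F (C.inclYdduu g)) =
        (τ.mod M).red ⟨(C.conjRoot hC (a ^ m) f.1 (C.inclYdduu g) : D.GtpTheta),
          (D.lDeltaTheta_normal l).conj_mem _ (hf.1 _) _⟩ := by
  refine C.heart_of_uniqueness_at' τ hC hS h15 γ hγ hL γΛ hγΛ M γμ hf F hF hFmul hFc a ha b hb huniq m hm ?_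
  -- `F b̃ = d · y^M · f b̃` in `l·Δ_Θ`, so `red_M d = red_M (F b̃) · red_M (f b̃)⁻¹` (`red_M (y^M) = 1`)
  have hF : F (C.inclYdduu b) = ⟨_, hm⟩ * y ^ ((M : ℕ+) : ℕ) * ⟨(f.1 (C.inclYdduu b) : D.GtpTheta), hf.1 _⟩ := by
    apply Subtype.ext
    rw [Subgroup.coe_mul, Subgroup.coe_mul, ← hval, inv_mul_cancel_right]
  rw [hF, (τ.mod M).red.map_mul, (τ.mod M).red.map_mul, (τ.mod M).red.map_pow, MuN.pow_card_eq_one, mul_one,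
    mul_inv_cancel_right]

/-! ## §4 (v2, append-only). The value clause for the INNER factor: `γ = Ad(x)` at `b` and `γ̃ = Ad(θx)` give (H.b) with `w := x⁻¹`

The adapter between a structure statement for admissible `γ` («`γ` acts at the point `b` as conjugation by some
`x ∈ Π^tp_X̲̲` — ANY element of the (profinite) group, no temperedness notion is involved — and `γ̃ = Ad(θ x)` on `l·Δ_Θ`»,
e.g. `γ = Ad(x) ∘ ν` with `ν` fixing `b` and inducing the identity on `l·Δ_Θ`) and the displayed clause (H.b) of
`cor219_iii_of_const_conjugator_of_origin` / abc-iut-L1-t6's `SettingModel.cor219_iii_modelχq_of_const_conjugator` (p490953):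
the transported value `γ̃⁻¹ f₀(γ b̃)` IS `conjRoot x⁻¹ f₀ b̃` on the nose (every function `f₀`, no reduction `red_M` needed), so
(H.b) holds with the SAME root cocycle and the constant conjugator `w := x⁻¹`. -/

/-- **Transport along an inner action at one point.**  If `γ b = x b x⁻¹` in `Π^tp_X̲̲` and `γ̃ d = θ(x) d θ(x)⁻¹` on `l·Δ_Θ`,
then `γ̃⁻¹ (f₀ (γ b̃)) = conjRoot x⁻¹ f₀ b̃` in `(Π^tp_X)^Θ`, for EVERY `Δ_Θ`-valued function `f₀` on `Π^tp_Ÿ̲̲`.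
[cite: MochizukiEtTh2009, Cor 2.19 (iii) p.65] -/
theorem transport_value_eq_conjRoot_inv_of_inner (hC : D.Compat) (hS : D.Sec2Hyps)
    (γ : (C.thetaEnvTower τ hC hS).PiX ≃ₜ* (C.thetaEnvTower τ hC hS).PiX)
    (hγ : (C.thetaEnvTower τ hC hS).PiYdd.map γ.toMulEquiv.toMonoidHom = (C.thetaEnvTower τ hC hS).PiYdd)
    (γΛ : D.lDeltaTheta l ≃* D.lDeltaTheta l) (x : C.Huu) (b : (C.thetaEnvTower τ hC hS).PiYdd)
    (hγb : γ (b : (C.thetaEnvTower τ hC hS).PiX) = x * b * x⁻¹)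
    (hγΛx : ∀ d : D.lDeltaTheta l,
      ((γΛ d : D.lDeltaTheta l) : D.GtpTheta) = D.toTheta (x : D.PiTemp) * d * (D.toTheta (x : D.PiTemp))⁻¹)
    (f₀ : C.GtpYdduu → D.DeltaTheta)
    (h₀ : (f₀ (C.inclYdduu ⟨γ b, C.apply_mem_PiYdd τ hC hS γ hγ b⟩) : D.GtpTheta) ∈ D.lDeltaTheta l) :
    ((γΛ.symm ⟨(f₀ (C.inclYdduu ⟨γ b, C.apply_mem_PiYdd τ hC hS γ hγ b⟩) : D.GtpTheta), h₀⟩ : D.lDeltaTheta l) :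
        D.GtpTheta) = (C.conjRoot hC x⁻¹ f₀ (C.inclYdduu b) : D.GtpTheta) := by
  -- `γ̃⁻¹ d = θ(x)⁻¹ d θ(x)`
  have hsymm : ∀ d : D.lDeltaTheta l,
      ((γΛ.symm d : D.lDeltaTheta l) : D.GtpTheta) = (D.toTheta (x : D.PiTemp))⁻¹ * d * D.toTheta (x : D.PiTemp) := by
    intro d
    have h1 := hγΛx (γΛ.symm d)
    rw [MulEquiv.apply_symm_apply] at h1
    rw [h1]
    group
  -- the point `γ b̃ = x b̃ x⁻¹ = (x⁻¹)⁻¹ b̃ x⁻¹` of `Π^tp_Ÿ̲̲`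
  have hpt : C.inclYdduu ⟨γ b, C.apply_mem_PiYdd τ hC hS γ hγ b⟩ = ⟨_, C.conj_mem_GtpYdduu hC x⁻¹ (C.inclYdduu b)⟩ := by
    apply Subtype.ext
    change (((γ (b : (C.thetaEnvTower τ hC hS).PiX) : (C.thetaEnvTower τ hC hS).PiX) : D.PiTemp)) =
      ((x⁻¹ : C.Huu) : D.PiTemp)⁻¹ * ((b : C.Huu) : D.PiTemp) * ((x⁻¹ : C.Huu) : D.PiTemp)
    rw [hγb, Subgroup.coe_mul, Subgroup.coe_mul, Subgroup.coe_inv, inv_inv]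
  rw [hsymm]
  change (D.toTheta (x : D.PiTemp))⁻¹ *
      ((f₀ (C.inclYdduu ⟨γ b, C.apply_mem_PiYdd τ hC hS γ hγ b⟩) : D.DeltaTheta) : D.GtpTheta) *
      D.toTheta (x : D.PiTemp) = _
  rw [hpt]
  change _ = ((MulAut.conjNormal (D.toTheta ((x⁻¹ : C.Huu) : D.PiTemp))
    (f₀ ⟨_, C.conj_mem_GtpYdduu hC x⁻¹ (C.inclYdduu b)⟩) : D.DeltaTheta) : D.GtpTheta)
  have hθ : D.toTheta ((x⁻¹ : C.Huu) : D.PiTemp) = (D.toTheta (x : D.PiTemp))⁻¹ := by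
    rw [Subgroup.coe_inv, map_inv]
  rw [MulAut.conjNormal_apply, hθ, inv_inv]

/-- **(H.b) for the inner factor**: under the hypotheses of `transport_value_eq_conjRoot_inv_of_inner` at the point `b`,
EVERY root cocycle `f₀` witnesses the value clause of `cor219_iii_of_const_conjugator_of_origin` with the constant
conjugator `w := x⁻¹` (at every level, by `congrArg red_M`). [cite: MochizukiEtTh2009, Cor 2.19 (iii) p.65] -/
theorem exists_const_value_of_inner (hC : D.Compat) (hS : D.Sec2Hyps)
    (γ : (C.thetaEnvTower τ hC hS).PiX ≃ₜ* (C.thetaEnvTower τ hC hS).PiX)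
    (hγ : (C.thetaEnvTower τ hC hS).PiYdd.map γ.toMulEquiv.toMonoidHom = (C.thetaEnvTower τ hC hS).PiYdd)
    (γΛ : D.lDeltaTheta l ≃* D.lDeltaTheta l) (x : C.Huu) (b : (C.thetaEnvTower τ hC hS).PiYdd)
    (hγb : γ (b : (C.thetaEnvTower τ hC hS).PiX) = x * b * x⁻¹)
    (hγΛx : ∀ d : D.lDeltaTheta l,
      ((γΛ d : D.lDeltaTheta l) : D.GtpTheta) = D.toTheta (x : D.PiTemp) * d * (D.toTheta (x : D.PiTemp))⁻¹)
    {f₀ : contCocycles D.toTheta D.DeltaTheta C.GtpYdduu} (hf₀ : f₀ ∈ C.rootCocycles hC) :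
    ∃ (f₁ : contCocycles D.toTheta D.DeltaTheta C.GtpYdduu) (hf₁ : f₁ ∈ C.rootCocycles hC) (w : C.Huu),
      ∀ M : Es,
        (τ.mod M).red (γΛ.symm ⟨(f₁.1 (C.inclYdduu ⟨γ b, C.apply_mem_PiYdd τ hC hS γ hγ b⟩) : D.GtpTheta), hf₁.1 _⟩) =
          (τ.mod M).red ⟨(C.conjRoot hC w f₁.1 (C.inclYdduu b) : D.GtpTheta),
            (D.lDeltaTheta_normal l).conj_mem _ (hf₁.1 _) _⟩ :=
  ⟨f₀, hf₀, x⁻¹, fun _ => congrArg _ (Subtype.ext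
    (C.transport_value_eq_conjRoot_inv_of_inner τ hC hS γ hγ γΛ x b hγb hγΛx f₀.1 (hf₀.1 _)))⟩

end ThetaSetting.EtaleThetaData.DoubleUnderline

end Literature.AnabelianGeometry.EtaleTheta

end
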